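import Mathlib.RingTheory.Ideal.KrullsHeightTheorem
import Literature.AlgebraicGeometry.Resolution.QuadraticTransformsRegular
import Summits.ResolutionOfSingularities.ResolutionOfSingularities.Theorems.ValuativeLuAlphaPTorsorFreeStepFree
import Summits.ResolutionOfSingularities.ResolutionOfSingularities.Theorems.ValuativeLuAlphaPTorsorFreeStepCorner

/-!
# Giraud's main induction along the sequence of quadratic transforms

Helper file for the stub `giraud_main_induction_of_dim` (M: the MAIN INDUCTION of Giraud's
Thm 2.4 along the quadratic sequence, in its GUARDED form: the dual-derivation schema is only
assumed at the stages of Krull dimension `2`, the only stages where it can hold and the only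
stages where it is used) of the line `pfaff-line-log-final-forms` (crux
`Valuative.LuAlphaPTorsor`, item `stmt-ResolutionOfSingularities-0641`).

Setting: `R 0 ⊆ R 1 ⊆ ⋯ ⊆ K` the sequence of quadratic transforms of a two-dimensional regular
local ring `R 0` along a valuation ring `O` dominating it, every member rich in `ℤ`-derivations
and every two-dimensional member carrying dual derivations of its regular systems of parameters.
Starting at a stage `i`
from a CORNER state (`C(f_i) = (u 0 ^ N 0 · u 1 ^ N 1) · J₀`, `J₀` of finite colength) or a
FREE state (`C_{u 0}(f_i) = (u 0 ^ a) · D₀`, `D₀` of finite colength), some later stage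
`j ≥ i` is either of dimension `≤ 1` or carries a MONOMIAL log-content
`C_E(f_j) = (∏_{l ∈ E} u l ^ N l)`.

Proof: strong induction on the measure `μ = 2 · λ(R i ⧸ J₀)` (corner) resp.
`μ = 2 · λ(R i ⧸ D₀) + 1` (free). If the finite part is the unit ideal we are done at `j = i`;
if `dim (R i) ≤ 1` we are done; otherwise `dim (R i) = 2` (Krull's height theorem: the maximal
ideal has two generators) and the three step theorems `giraud_corner_step_state`,
`giraud_free_step_free`, `giraud_free_step_corner` produce either `dim (R (i + 1)) ≤ 1` or a
state at `R (i + 1)` of strictly smaller measure (corner → corner/free with `λ` strictly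
smaller; free → free with `λ` strictly smaller; free → corner with `λ` not larger).

References: J. Giraud, *Forme normale d'une fonction sur une surface de caractéristique
positive*, Bull. SMF 111 (1983), Lemme 2.3, Thm. 2.4, §2.5.
-/

set_option linter.dupNamespace false

noncomputable section

open IsLocalRing Literature.AlgebraicGeometry.Resolution

namespace Summit.ResolutionOfSingularities.ResolutionOfSingularities.Theorems.PfaffLine

section MainInductionDimHelpers

/-- In a local ring, an ideal consists exactly of the non-units iff it is the maximal ideal.
[folklore] -/
theorem forall_mem_iff_not_isUnit_iff_mainInductionDim {S : Type*} [CommRing S] [IsLocalRing S]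
    {I : Ideal S} : (∀ z : S, z ∈ I ↔ ¬ IsUnit z) ↔ I = maximalIdeal S := by
  constructor
  · intro h
    ext z
    exact (h z).trans (mem_nonunits_iff.symm.trans (mem_maximalIdeal z).symm)
  · rintro rfl z
    exact (mem_maximalIdeal z).trans mem_nonunits_iff

/-- **Krull's height theorem, two generators.** If the maximal ideal of a Noetherian local ring
is generated by a family indexed by `Fin 2`, then its Krull dimension is `≤ 1` or `= 2`.
[folklore] -/
theorem ringKrullDim_le_one_or_eq_two_mainInductionDim {S : Type*} [CommRing S] [IsLocalRing S]
    [IsNoetherianRing S] (u : Fin 2 → S) (hspan : Ideal.span (Set.range u) = maximalIdeal S) :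
    ringKrullDim S ≤ 1 ∨ ringKrullDim S = 2 := by
  classical
  have hmin : maximalIdeal S ∈
      (Ideal.span ((Finset.univ.image u : Finset S) : Set S)).minimalPrimes := by
    rw [Finset.coe_image, Finset.coe_univ, Set.image_univ, hspan,
      Ideal.minimalPrimes_eq_subsingleton_self]
    exact Set.mem_singleton _
  have hcard : (Finset.univ.image u).card ≤ 2 :=
    Finset.card_image_le.trans (by rw [Finset.card_univ, Fintype.card_fin])
  have hh : (maximalIdeal S).height ≤ 2 :=
    (Ideal.height_le_card_of_mem_minimalPrimes_span_finset hmin).trans (by exact_mod_cast hcard)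
  rw [← IsLocalRing.maximalIdeal_height_eq_ringKrullDim]
  generalize (maximalIdeal S).height = d at hh
  induction d using ENat.recTopCoe with
  | top => exact absurd (top_le_iff.mp hh) (by simp)
  | coe n =>
    have hn : n ≤ 2 := by exact_mod_cast hh
    rcases Nat.lt_or_ge n 2 with hlt | hge
    · have h1 : (n : ℕ∞) ≤ (1 : ℕ∞) := by exact_mod_cast (show n ≤ 1 by omega)
      exact Or.inl (WithBot.coe_le_coe.mpr h1)
    · obtain rfl : n = 2 := le_antisymm hn hge
      exact Or.inr rfl

/-- Strict monotonicity of `ENat.toNat` below a finite bound. [folklore] -/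
theorem toNat_lt_toNat_mainInductionDim {m n : ℕ∞} (h : m < n) (hn : n ≠ ⊤) :
    m.toNat < n.toNat := by
  lift n to ℕ using hn
  lift m to ℕ using ne_top_of_lt h
  simp only [ENat.toNat_coe]
  exact_mod_cast h

end MainInductionDimHelpers

open IsLocalRing

/-- **Registered stub `giraud_main_induction_of_dim`** (M: the main induction of Giraud's
Thm 2.4 along the sequence of quadratic transforms, guarded form: dual derivations are assumed
only at the two-dimensional stages). From a CORNER state
(`C(f_i) = (u 0 ^ N 0 · u 1 ^ N 1) · J₀`, `J₀` of finite colength) or a FREE state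
(`C_{u 0}(f_i) = (u 0 ^ a) · D₀`, `D₀` of finite colength) at the stage `i`, some stage `j ≥ i`
has dimension `≤ 1` or a monomial log-content. Strong induction on
`2 · λ(R i ⧸ J₀)` / `2 · λ(R i ⧸ D₀) + 1`: a unit finite part is a monomial content at `j = i`;
otherwise `dim (R i) = 2` (or we are done) and the step theorems `giraud_corner_step_state`,
`giraud_free_step_free`, `giraud_free_step_corner` (fed with the dual derivations of the
two-dimensional stage `i`) give `dim (R (i + 1)) ≤ 1` or a state at `R (i + 1)` of strictly
smaller measure. [folklore] -/
theorem giraud_main_induction_of_dim : ∀ {K : Type} [Field K] (O : ValuationSubring K) (R : ℕ → Subring K), IsRegularLocalRing (R 0) → ringKrullDim (R 0) = 2 → Literature.AlgebraicGeometry.Resolution.SubringDominates (R 0) O.toSubring → ∀ (hstep : ∀ i, Literature.AlgebraicGeometry.Resolution.IsQuadraticTransformAlong O (R i) (R (i + 1))), (∀ (i : ℕ) (N : Type) [CommRing N] (ψ : R i →+* N) (δ₀ : R i →+ N), (∀ a b, δ₀ (a * b) = ψ a * δ₀ b + ψ b * δ₀ a) → ∀ Y : Finset (R i), ∃ (m :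 ℕ) (Δ : Fin m → Derivation ℤ (R i) (R i)) (nn : Fin m → N), ∀ y ∈ Y, δ₀ y = Finset.univ.sum fun j => ψ (Δ j y) * nn j) → (∀ (i : ℕ) (v : Fin 2 → R i), ringKrullDim (R i) = 2 → (∀ z : R i, z ∈ Ideal.span (Set.range v) ↔ ¬ IsUnit z) → ∃ D : Fin 2 → Derivation ℤ (R i) (R i), ∀ l j, D l (v j) = if l = j then 1 else 0) → ∀ (f : R 0) (i : ℕ), ((∃ (u : Fin 2 → R i) (N : Fin 2 → ℕ) (J₀ : Ideal (R i)), (∀ z : R i, z ∈ Ideal.span (Set.range u) ↔ ¬ IsUnit z) ∧ Ideal.span {b | ∃ δ : Derivation ℤ (R i) (R i), (∀ l ∈ (Finset.univ : Finset (Fin 2)), δ (u l) ∈ Ideal.span {u l}) ∧ δ (Subring.inclusion (Literature.AlgebraicGeometry.Resolution.sequence_monotone hstep (Nat.zero_le i)) f) = b} = Ideal.span {Finset.univ.prod fun l => u l ^ N l} * J₀ ∧ IsFiniteLength (R i) (R i ⧸ J₀)) ∨ (∃ (u : Fin 2 → R i) (a : ℕ) (D₀ : Ideal (R i)), (∀ z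 : R i, z ∈ Ideal.span (Set.range u) ↔ ¬ IsUnit z) ∧ Ideal.span {b | ∃ δ : Derivation ℤ (R i) (R i), (∀ l ∈ ({0} : Finset (Fin 2)), δ (u l) ∈ Ideal.span {u l}) ∧ δ (Subring.inclusion (Literature.AlgebraicGeometry.Resolution.sequence_monotone hstep (Nat.zero_le i)) f) = b} = Ideal.span {u 0 ^ a} * D₀ ∧ IsFiniteLength (R i) (R i ⧸ D₀))) → ∃ j : ℕ, i ≤ j ∧ (ringKrullDim (R j) ≤ 1 ∨ ∃ (u : Fin 2 → R j) (E : Finset (Fin 2)) (N : Fin 2 → ℕ), (∀ z : R j, z ∈ Ideal.span (Set.range u) ↔ ¬ IsUnit z) ∧ Ideal.span {b | ∃ δ : Derivation ℤ (R j) (R j), (∀ l ∈ E, δ (u l) ∈ Ideal.span {u l}) ∧ δ (Subring.inclusion (Literature.AlgebraicGeometry.Resolution.sequence_monotone hstep (Nat.zero_le j)) f) = b} = Ideal.span {E.prod fun l => u l ^ N l}) := by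
  intro K _ O R hreg hdim0 hdom hstep hrich hdual f
  classical
  -- the induction claim, on the measure `2 · λ` (corner) / `2 · λ + 1` (free)
  suffices key : ∀ (n i : ℕ),
      ((∃ (u : Fin 2 → R i) (N : Fin 2 → ℕ) (J₀ : Ideal (R i)),
          (∀ z : R i, z ∈ Ideal.span (Set.range u) ↔ ¬ IsUnit z) ∧
          Ideal.span {b | ∃ δ : Derivation ℤ (R i) (R i),
              (∀ l ∈ (Finset.univ : Finset (Fin 2)), δ (u l) ∈ Ideal.span {u l}) ∧
                δ (Subring.inclusion (sequence_monotone hstep (Nat.zero_le i)) f) = b} =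
            Ideal.span {Finset.univ.prod fun l => u l ^ N l} * J₀ ∧
          IsFiniteLength (R i) (R i ⧸ J₀) ∧
          2 * (Module.length (R i) (R i ⧸ J₀)).toNat = n) ∨
        (∃ (u : Fin 2 → R i) (a : ℕ) (D₀ : Ideal (R i)),
          (∀ z : R i, z ∈ Ideal.span (Set.range u) ↔ ¬ IsUnit z) ∧
          Ideal.span {b | ∃ δ : Derivation ℤ (R i) (R i),
              (∀ l ∈ ({0} : Finset (Fin 2)), δ (u l) ∈ Ideal.span {u l}) ∧
                δ (Subring.inclusion (sequence_monotone hstep (Nat.zero_le i)) f) = b} =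
            Ideal.span {u 0 ^ a} * D₀ ∧
          IsFiniteLength (R i) (R i ⧸ D₀) ∧
          2 * (Module.length (R i) (R i ⧸ D₀)).toNat + 1 = n)) →
      ∃ j : ℕ, i ≤ j ∧ (ringKrullDim (R j) ≤ 1 ∨
        ∃ (u : Fin 2 → R j) (E : Finset (Fin 2)) (N : Fin 2 → ℕ),
          (∀ z : R j, z ∈ Ideal.span (Set.range u) ↔ ¬ IsUnit z) ∧
          Ideal.span {b | ∃ δ : Derivation ℤ (R j) (R j),
              (∀ l ∈ E, δ (u l) ∈ Ideal.span {u l}) ∧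
                δ (Subring.inclusion (sequence_monotone hstep (Nat.zero_le j)) f) = b} =
            Ideal.span {E.prod fun l => u l ^ N l}) by
    intro i hst
    rcases hst with ⟨u, N, J₀, hu, hJ, hfin⟩ | ⟨u, a, D₀, hu, hD, hfin⟩
    · exact key _ i (Or.inl ⟨u, N, J₀, hu, hJ, hfin, rfl⟩)
    · exact key _ i (Or.inr ⟨u, a, D₀, hu, hD, hfin, rfl⟩)
  intro n
  induction n using Nat.strong_induction_on with
  | _ n ih =>
  intro i hst
  -- the members of the sequence are regular local rings dominated by `O`
  haveI : IsRegularLocalRing (R i) := isRegularLocalRing_sequence hreg hstep i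
  haveI : IsRegularLocalRing (R (i + 1)) := isRegularLocalRing_sequence hreg hstep (i + 1)
  have hdomi : SubringDominates (R i) O.toSubring := (sequence_dominates hdom hstep i).1
  -- the dual derivations are available at the stage `i` once `dim (R i) = 2` is known
  have hduali : ringKrullDim (R i) = 2 → ∀ v : Fin 2 → R i,
      Ideal.span (Set.range v) = maximalIdeal (R i) →
        ∃ D : Fin 2 → Derivation ℤ (R i) (R i), ∀ l j, D l (v j) = if l = j then 1 else 0 :=
    fun h2 v hv => hdual i v h2 (forall_mem_iff_not_isUnit_iff_mainInductionDim.mpr hv)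
  have hfi : Subring.inclusion (hstep i).le
      (Subring.inclusion (sequence_monotone hstep (Nat.zero_le i)) f) =
      Subring.inclusion (sequence_monotone hstep (Nat.zero_le (i + 1))) f := Subtype.ext rfl
  rcases hst with ⟨u, N, J₀, hu, hJ, hfin, hn⟩ | ⟨u, a, D₀, hu, hD, hfin, hn⟩
  · -- CORNER state at the stage `i`
    by_cases hJtop : J₀ = ⊤
    · -- unit finite part: the content is already monomial
      refine ⟨i, le_rfl, Or.inr ⟨u, Finset.univ, N, hu, ?_⟩⟩
      rw [hJ, hJtop, Ideal.mul_top]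
    have hspan : Ideal.span (Set.range u) = maximalIdeal (R i) :=
      forall_mem_iff_not_isUnit_iff_mainInductionDim.mp hu
    rcases ringKrullDim_le_one_or_eq_two_mainInductionDim u hspan with h1 | h2
    · exact ⟨i, le_rfl, Or.inl h1⟩
    have hne : Module.length (R i) (R i ⧸ J₀) ≠ ⊤ := Module.length_ne_top_iff.mpr hfin
    rcases giraud_corner_step_state O (R i) (R (i + 1)) (hstep i) h2 hdomi (hrich i) (hduali h2) u
        hspan (Subring.inclusion (sequence_monotone hstep (Nat.zero_le i)) f) N J₀ hJ hfin hJtop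
      with h1 | ⟨u₁, N₁, J₁, hu₁, hJ₁, hfin₁, hlt⟩ | ⟨u₁, a₁, D₁, hu₁, hD₁, hfin₁, hlt⟩
    · exact ⟨i + 1, Nat.le_succ i, Or.inl h1⟩
    · -- corner successor, colength strictly smaller
      have hc := toNat_lt_toNat_mainInductionDim hlt hne
      obtain ⟨j, hij, hj⟩ := ih (2 * (Module.length (R (i + 1)) (R (i + 1) ⧸ J₁)).toNat)
        (by omega) (i + 1)
        (Or.inl ⟨u₁, N₁, J₁, forall_mem_iff_not_isUnit_iff_mainInductionDim.mpr hu₁,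
          by rw [← hfi]; exact hJ₁, hfin₁, rfl⟩)
      exact ⟨j, (Nat.le_succ i).trans hij, hj⟩
    · -- free successor, colength strictly smaller
      have hc := toNat_lt_toNat_mainInductionDim hlt hne
      obtain ⟨j, hij, hj⟩ := ih (2 * (Module.length (R (i + 1)) (R (i + 1) ⧸ D₁)).toNat + 1)
        (by omega) (i + 1)
        (Or.inr ⟨u₁, a₁, D₁, forall_mem_iff_not_isUnit_iff_mainInductionDim.mpr hu₁,
          by rw [← hfi]; exact hD₁, hfin₁, rfl⟩)
      exact ⟨j, (Nat.le_succ i).trans hij, hj⟩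
  · -- FREE state at the stage `i`
    by_cases hDtop : D₀ = ⊤
    · -- unit finite part: the content is already monomial, boundary `{u 0}`
      refine ⟨i, le_rfl, Or.inr ⟨u, {0}, fun _ => a, hu, ?_⟩⟩
      rw [Finset.prod_singleton, hD, hDtop, Ideal.mul_top]
    have hspan : Ideal.span (Set.range u) = maximalIdeal (R i) :=
      forall_mem_iff_not_isUnit_iff_mainInductionDim.mp hu
    rcases ringKrullDim_le_one_or_eq_two_mainInductionDim u hspan with h1 | h2
    · exact ⟨i, le_rfl, Or.inl h1⟩
    have hne : Module.length (R i) (R i ⧸ D₀) ≠ ⊤ := Module.length_ne_top_iff.mpr hfin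
    by_cases hmin : ∀ z ∈ maximalIdeal (R i), O.valuation (z : K) ≤ O.valuation ((u 0 : R i) : K)
    · -- `u 0` of minimal value: free step with free successor (or dimension drop)
      rcases giraud_free_step_free O (R i) (R (i + 1)) (hstep i) h2 hdomi (hrich i) (hduali h2) u
          hspan 0 hmin (Subring.inclusion (sequence_monotone hstep (Nat.zero_le i)) f) a D₀ hD
          hfin hDtop with h1 | ⟨u₁, a₁, D₁, -, hu₁, hD₁, hfin₁, hlt⟩
      · exact ⟨i + 1, Nat.le_succ i, Or.inl h1⟩
      · have hc := toNat_lt_toNat_mainInductionDim hlt hne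
        obtain ⟨j, hij, hj⟩ := ih (2 * (Module.length (R (i + 1)) (R (i + 1) ⧸ D₁)).toNat + 1)
          (by omega) (i + 1)
          (Or.inr ⟨u₁, a₁, D₁, forall_mem_iff_not_isUnit_iff_mainInductionDim.mpr hu₁,
            by rw [← hfi]; exact hD₁, hfin₁, rfl⟩)
        exact ⟨j, (Nat.le_succ i).trans hij, hj⟩
    · -- `u 0` not of minimal value: free step with corner successor
      obtain ⟨u₁, N₁, J₁, hu₁, hJ₁, hfin₁, hle⟩ := giraud_free_step_corner O (R i) (R (i + 1))
        (hstep i) h2 hdomi (hrich i) (hduali h2) u hspan 0 hmin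
        (Subring.inclusion (sequence_monotone hstep (Nat.zero_le i)) f) a D₀ hD hfin hDtop
      have hc := ENat.toNat_le_toNat hle hne
      obtain ⟨j, hij, hj⟩ := ih (2 * (Module.length (R (i + 1)) (R (i + 1) ⧸ J₁)).toNat)
        (by omega) (i + 1)
        (Or.inl ⟨u₁, N₁, J₁, forall_mem_iff_not_isUnit_iff_mainInductionDim.mpr hu₁,
          by rw [← hfi]; exact hJ₁, hfin₁, rfl⟩)
      exact ⟨j, (Nat.le_succ i).trans hij, hj⟩

end Summit.ResolutionOfSingularities.ResolutionOfSingularities.Theorems.PfaffLine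

end
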